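import Summits.AnomalousDissipation.AnomalousDissipation.Theorems.UniformResolution.Negative.ResolutionCriterion
import Summits.AnomalousDissipation.AnomalousDissipation.Theorems.CubicParityLoud.Negative.Clauses

/-!
# `MomentParity.ResolvedDissipation` (stmt-AnomalousDissipation-14284), line `enstrophy-ui-transfer`:
# RESOLUTION IN MEASURE is free — the crux's residue is the MEAN of rare large excursions

Supports stmt-AnomalousDissipation-14284 (helper of the line lead; nothing here closes an item).

The crux asks for resolution of the MEAN enstrophy by one schedule, `∫ tail_{κ n} dμ ≤ 1/(n+1)` uniformly over the
admissible family (`tail_K = ‖∇u‖² − ‖∇P_K u‖² = Torus.tailGradNormSq K`). This file proves, by the same spectral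
Chebyshev step as the landed resolution criterion (`Theorems/UniformResolution/Negative/ResolutionCriterion.lean`)
but with Markov's inequality in place of uniform integrability, that resolution IN MEASURE holds for every family
with a uniform weighted `H²` bound and a uniform mean-enstrophy budget — both of which the admissible family of the
crux has `N`-uniformly (FGT bound, energy row):

* `exists_schedule_resolvedInMeasure` — `WeightedH2Bound p 𝓕` and `sup_𝓕 ∫‖∇u‖² ≤ G < ∞` give ONE `κ` with
  `μ{u : tail_{κ n}(u) > 1/(n+1)} ≤ 1/(n+1)` for all `n` and all `μ ∈ 𝓕`.

So along any leaking sequence of the crux's kill shape (Disproof §5) the unresolved enstrophy `tail_K` converges to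
`0` in measure, uniformly, while keeping mean `≥ δ`: the leak is carried by events of vanishing probability and
diverging enstrophy — exactly the failure of uniform integrability (`…Converse.lean`, the hard stub of the line).
-/

noncomputable section

-- `Summit.<Summit>.<Problem>`: single-conjunct summit, the duplicate namespace segment is mandated.
set_option linter.dupNamespace false

namespace Summit.AnomalousDissipation.AnomalousDissipation.Theorems.MomentParityResolvedDissipation

open MeasureTheory Filter Topology
open scoped ENNReal InnerProductSpace RealInnerProductSpace
open Literature.Analysis.FunctionSpaces Literature.Analysis.FluidPDE
open Summit.AnomalousDissipation.AnomalousDissipation.Theses.MomentParity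
open Summit.AnomalousDissipation.AnomalousDissipation.Theorems.CubicParityLoud.Negative (T3 R3 H3 L2T3)
open Summit.AnomalousDissipation.AnomalousDissipation.Theorems.UniformResolution.Negative
  (eLapNormSq WeightedH2Bound tailGradNormSq_mul_le_eLapNormSq measurable_eLapNormSq_coe
    measurable_tailGradNormSq_coe)

/-- **RESOLUTION IN MEASURE from a weighted `H²` bound and a mean-enstrophy budget.** Let `𝓕` be a family of laws
on `H` with `∫ |Au|²/(1+‖∇u‖²)^p dμ ≤ C < ∞` (`WeightedH2Bound p 𝓕`) and `∫ ‖∇u‖² dμ ≤ G < ∞` for all `μ ∈ 𝓕`.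
Then ONE schedule `κ` resolves the enstrophy of every law of the family IN MEASURE:
`μ {u : tail_{κ n}(u) > 1/(n+1)} ≤ 1/(n+1)` for all `n`, where `tail_K = Torus.tailGradNormSq K` is the enstrophy
beyond the cutoff `K`. Proof: Markov twice (`μ{‖∇u‖² ≥ L} ≤ G/L`, `μ{w ≥ a} ≤ C/a`, `w = |Au|²/(1+‖∇u‖²)^p`) and,
off these two events, spectral Chebyshev `4π²(K²+1) tail_K ≤ |Au|² = w(1+‖∇u‖²)^p < a(1+L)^p`. Contrast: resolution
IN MEAN (the crux) needs uniform integrability of `‖∇u‖²` (`exists_isResolved_of_uniformlyIntegrable_of_weightedH2`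
and its converse). [folklore] -/
theorem exists_schedule_resolvedInMeasure :
    ∀ (𝓕 : Set (Measure H3)) (p : ℕ) (G : ℝ≥0∞), WeightedH2Bound p 𝓕 → G ≠ ⊤ →
    (∀ μ ∈ 𝓕, ∫⁻ u, Torus.eGradNormSq (u.1 : T3 → R3) ∂μ ≤ G) →
    ∃ κ : ℕ → ℕ, ∀ μ ∈ 𝓕, ∀ n : ℕ,
      μ {u : H3 | ((n : ℝ≥0∞) + 1)⁻¹ < Torus.tailGradNormSq (κ n) (u.1 : T3 → R3)} ≤ ((n : ℝ≥0∞) + 1)⁻¹ := by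
  intro 𝓕 p G hH2 hG hZ
  obtain ⟨C, hC, hH2⟩ := hH2
  -- abbreviations
  let eG : H3 → ℝ≥0∞ := fun u => Torus.eGradNormSq (u.1 : T3 → R3)
  let eL : H3 → ℝ≥0∞ := fun u => eLapNormSq (u.1 : T3 → R3)
  let tl : ℕ → H3 → ℝ≥0∞ := fun m u => Torus.tailGradNormSq m (u.1 : T3 → R3)
  let w : H3 → ℝ≥0∞ := fun u => eL u / (1 + eG u) ^ p
  have heG : Measurable eG := Torus.measurable_eGradNormSq_coe
  have heL : Measurable eL := measurable_eLapNormSq_coe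
  have hw : Measurable w := heL.div ((measurable_const.add heG).pow_const p)
  -- for each `n`, one cutoff `m`
  have key : ∀ n : ℕ, ∃ m : ℕ, ∀ μ ∈ 𝓕,
      μ {u : H3 | ((n : ℝ≥0∞) + 1)⁻¹ < tl m u} ≤ ((n : ℝ≥0∞) + 1)⁻¹ := by
    intro n
    set ε : ℝ≥0∞ := ((n : ℝ≥0∞) + 1)⁻¹ with hε
    set η : ℝ≥0∞ := (2 * ((n : ℝ≥0∞) + 1))⁻¹ with hη
    have hn1 : (n : ℝ≥0∞) + 1 ≠ 0 := by simp
    have hn1' : (n : ℝ≥0∞) + 1 ≠ ⊤ := by simp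
    have h2n : (2 : ℝ≥0∞) * ((n : ℝ≥0∞) + 1) ≠ ⊤ := ENNReal.mul_ne_top (by simp) hn1'
    have h2n0 : (2 : ℝ≥0∞) * ((n : ℝ≥0∞) + 1) ≠ 0 := mul_ne_zero two_ne_zero hn1
    have hε0 : ε ≠ 0 := ENNReal.inv_ne_zero.2 hn1'
    have hεtop : ε ≠ ⊤ := ENNReal.inv_ne_top.2 hn1
    have hηtop : η ≠ ⊤ := ENNReal.inv_ne_top.2 h2n0
    have hηη : η + η = ε := by
      rw [← two_mul, hη, hε, ENNReal.mul_inv (Or.inl two_ne_zero) (Or.inl ENNReal.ofNat_ne_top),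
        ← mul_assoc, ENNReal.mul_inv_cancel two_ne_zero ENNReal.ofNat_ne_top, one_mul]
    -- Markov thresholds
    set L : ℝ≥0∞ := 2 * ((n : ℝ≥0∞) + 1) * (G + 1) with hL
    set a : ℝ≥0∞ := 2 * ((n : ℝ≥0∞) + 1) * (C + 1) with ha
    have hG1 : G + 1 ≠ ⊤ := by simpa using hG
    have hC1 : C + 1 ≠ ⊤ := by simpa using hC
    have hLtop : L ≠ ⊤ := ENNReal.mul_ne_top h2n hG1
    have hatop : a ≠ ⊤ := ENNReal.mul_ne_top h2n hC1
    have hL0 : L ≠ 0 := mul_ne_zero h2n0 (by simp)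
    have ha0 : a ≠ 0 := mul_ne_zero h2n0 (by simp)
    -- the cutoff
    set D : ℝ≥0∞ := a * (1 + L) ^ p / ε with hD_def
    have h1L : 1 + L ≠ ⊤ := by simpa using hLtop
    have hD : D ≠ ⊤ := ENNReal.div_ne_top (ENNReal.mul_ne_top hatop (ENNReal.pow_ne_top h1L)) hε0
    obtain ⟨m, hm⟩ := ENNReal.exists_nat_gt hD
    refine ⟨m, fun μ hμ => ?_⟩
    set X : ℝ≥0∞ := ENNReal.ofReal (4 * Real.pi ^ 2 * ((m : ℝ) ^ 2 + 1)) with hX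
    have hX0 : X ≠ 0 := (ENNReal.ofReal_pos.2 (by positivity)).ne'
    have hXtop : X ≠ ⊤ := ENNReal.ofReal_ne_top
    have hmX : (m : ℝ≥0∞) ≤ X := by
      rw [hX, ← ENNReal.ofReal_natCast]
      apply ENNReal.ofReal_le_ofReal
      have hpi : 3 < Real.pi := Real.pi_gt_three
      have h1 : (m : ℝ) ≤ (m : ℝ) ^ 2 + 1 := by nlinarith [sq_nonneg ((m : ℝ) - 1)]
      have h2 : (1 : ℝ) ≤ 4 * Real.pi ^ 2 := by nlinarith
      have h3 : (0 : ℝ) ≤ (m : ℝ) ^ 2 + 1 := by positivity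
      nlinarith
    have hDX : a * (1 + L) ^ p ≤ ε * X := by
      have h : D < X := hm.trans_le hmX
      rw [hD_def, ENNReal.div_lt_iff (Or.inl hε0) (Or.inl hεtop)] at h
      rw [mul_comm ε X]
      exact h.le
    -- the two Markov events
    set SZ : Set H3 := {u | L ≤ eG u} with hSZ
    set SW : Set H3 := {u | a ≤ w u} with hSW
    have hMZ : μ SZ ≤ η := by
      have h1 : L * μ SZ ≤ ∫⁻ u, eG u ∂μ := mul_meas_ge_le_lintegral heG L
      have h2 : L * μ SZ ≤ G + 1 := h1.trans ((hZ μ hμ).trans le_self_add)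
      calc μ SZ = L⁻¹ * (L * μ SZ) := by rw [← mul_assoc, ENNReal.inv_mul_cancel hL0 hLtop, one_mul]
        _ ≤ L⁻¹ * (G + 1) := by gcongr
        _ = η := by
            rw [hL, hη, ENNReal.mul_inv (Or.inl h2n0) (Or.inl h2n), mul_assoc,
              ENNReal.inv_mul_cancel (by simp) hG1, mul_one]
    have hMW : μ SW ≤ η := by
      have h1 : a * μ SW ≤ ∫⁻ u, w u ∂μ := mul_meas_ge_le_lintegral hw a
      have h2 : a * μ SW ≤ C + 1 := h1.trans ((hH2 μ hμ).trans le_self_add)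
      calc μ SW = a⁻¹ * (a * μ SW) := by rw [← mul_assoc, ENNReal.inv_mul_cancel ha0 hatop, one_mul]
        _ ≤ a⁻¹ * (C + 1) := by gcongr
        _ = η := by
            rw [ha, hη, ENNReal.mul_inv (Or.inl h2n0) (Or.inl h2n), mul_assoc,
              ENNReal.inv_mul_cancel (by simp) hC1, mul_one]
    -- off the two events the tail is resolved pointwise
    have hsub : {u : H3 | ε < tl m u} ⊆ SZ ∪ SW := by
      intro u hu
      by_contra hnot
      simp only [Set.mem_union, not_or] at hnot
      have hZu : eG u < L := not_le.1 hnot.1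
      have hwu : w u < a := not_le.1 hnot.2
      have htopu : eG u ≠ ⊤ := hZu.ne_top
      have hb0 : (1 + eG u) ^ p ≠ 0 := pow_ne_zero _ (by simp)
      have hbtop : (1 + eG u) ^ p ≠ ⊤ := ENNReal.pow_ne_top (by simpa using htopu)
      have h1 : tl m u ≤ eL u / X := by
        rw [ENNReal.le_div_iff_mul_le (Or.inl hX0) (Or.inl hXtop)]
        exact tailGradNormSq_mul_le_eLapNormSq m _
      have h2 : eL u = w u * (1 + eG u) ^ p := (ENNReal.div_mul_cancel hb0 hbtop).symm
      have h3 : eL u ≤ a * (1 + L) ^ p := by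
        rw [h2]
        have hwu' := hwu.le
        have hZu' := hZu.le
        calc w u * (1 + eG u) ^ p ≤ a * (1 + eG u) ^ p := by gcongr
          _ ≤ a * (1 + L) ^ p := by gcongr
      have h4 : tl m u ≤ ε := by
        calc tl m u ≤ eL u / X := h1
          _ ≤ (a * (1 + L) ^ p) / X := by gcongr
          _ ≤ (ε * X) / X := by gcongr
          _ = ε := ENNReal.mul_div_cancel_right hX0 hXtop
      exact absurd hu (not_lt.2 h4)
    calc μ {u : H3 | ε < tl m u} ≤ μ (SZ ∪ SW) := measure_mono hsub
      _ ≤ μ SZ + μ SW := measure_union_le _ _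
      _ ≤ η + η := add_le_add hMZ hMW
      _ = ε := hηη
  choose κ hκ using key
  exact ⟨κ, fun μ hμ n => hκ n μ hμ⟩

end Summit.AnomalousDissipation.AnomalousDissipation.Theorems.MomentParityResolvedDissipation

end
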